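import Literature.AlgebraicGeometry.HodgeTheory.WeilClassesFieldTypeFourIsogenousPowersEndLevel
import Literature.AlgebraicGeometry.HodgeTheory.WeilClassesFieldTypeFourExceptionalHodgeClasses
import Literature.AlgebraicGeometry.HodgeTheory.WeilClassesFieldDefiniteQuaternionMatricesEndLevel
import HarnessLib

/-!
# Moonen–Zarhin's Criterion, «`X` isogenous to `Y^m`», TYPES 3 AND 4, FROM `End(Y)`-LEVEL DATA: the type-3 parity
# dichotomy for every `X ∼ A^{n+1}` (and, over centre `ℚ`, «decomposable ⟺ `dim A ∣ m`»), and Criteria (1)+(2)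
# assembled up to isogeny — WHEN DOES `W_F(X)` CONSIST OF EXCEPTIONAL HODGE CLASSES (Moonen–Zarhin 1998 §1)

Layer `Literature/AlgebraicGeometry/HodgeTheory`; THEOREMS ONLY — no definition, no named fact, no `sorry` (D-0026, net
debt 0).  Assembly of three files of the seat — `WeilClassesFieldTypeFourIsogenousPowersEndLevel` (generation 26, g26-#3:
Criterion (2), type 4, for `Z ∼ A^{n+1}` from `End(A)`-level CM-centre data, through the transport of `F = ℚ(φ) ⊂ End⁰(Z)`
to `ℚ(f ≫ φ ≫ g) ⊂ End⁰(A^{n+1})` with `P_k = P.scaleRoots k`), `WeilClassesFieldTypeFourExceptionalHodgeClasses` (g26-#7: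
Criteria (1)+(2) assembled for type 4 ON `X`) and `WeilClassesFieldDefiniteQuaternionMatricesEndLevel` (g23-#5:
Criterion (2), type 3, ON THE POWERS `A^{n+1}` from an `End(A)`-level presentation `End⁰(A) = ℚ⟨ψ, α, β⟩` of a
definite quaternion algebra) — with the lane's `Deligne1982.weilClassesField_le_hodgeClassSpan_iff_forall_eigenMultiplicity_eq`
(Criterion (1) «`W_F` consists of Hodge classes ⟺ `n_σ = n_σ̄`», which holds ON `Z` directly) and the seat's transport
`WeilClassesFieldIsogenyTransportOfStructure` (generation 18).  The print states the Criterion for «`X` isogenous to a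
power `Y^m`»; the type-3 rows of the tree were so far stated on the powers `A^{n+1}` themselves, and the assembled
«exceptional Hodge classes» statement only on `X` with `End(X)`-level data.  This file closes both gaps.

## The print

B. J. J. Moonen, Yu. G. Zarhin, *Weil classes on abelian varieties*, J. reine angew. Math. **496** (1998) 83–92 =
arXiv:alg-geom/9612017 [MoonenZarhin1998WeilClasses] (held text `paper:arxiv-alg-geom_9612017`), VERBATIM.  Chunk p0001
L10–L12: «The non-decomposable Hodge classes are called exceptional classes.»; L46–L50: «Q1: under what conditions on `F`
does `W_F` contain, or even consist of, Hodge classes?  Q2: if `W_F` contains Hodge classes, under what conditions on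
`F` are these exceptional?»; chunk p0002 L45–L46: «Since everything only depends on `X` up to isogeny, we may even assume
that `X = Y^m` for some `m ≥ 1`, where `Y` is simple.»; chunk p0003 L59–L80, Criterion: «Suppose `X` is isogenous to a
power `Y^m` of a simple abelian variety `Y` … Suppose `F ↪ End⁰(X)` is a subfield such that `W_F = ⋀^r_F V_X` consists
of Hodge classes (see section (crit1) …).  Then either all classes in `W_F` are decomposable, or all non-zero classes in
`W_F` are exceptional; this last possibility occurs precisely in the following cases: `Y` is of Type 3, `m = 1` and
`F ⊄ E`, `Y` is of Type 3, `m ≥ 2` and the integer `2m · [E:ℚ] / [F:ℚ]` is odd, `Y` is of Type 4, `d = 1`, `m = 1` and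
`F ⊄ E₀`, `Y` is of Type 4 with `d ≥ 2` or `m ≥ 2` and the map `θ : E₋ ↪ End_F(V_X) —Tr_F→ F` is non-zero.»; proof,
type 3 with `m ≥ 2` (chunk p0003 L107–L127, chunk p0004 L1–L27): «`W_F` consists of decomposable Hodge classes if and
only if the integer `2m[E:ℚ]/[F:ℚ]` is even».  Criterion (1) (chunk p0002, section (crit1)): «`W_F` consists of Hodge
classes if and only if … `n_σ = n_{σ̄}` for all `σ ∈ Σ_F`» = P. Deligne, *Hodge cycles on abelian varieties*, LNM 900
(1982) [Deligne1982HodgeCycles], Prop. 4.4.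
B. van Geemen [vanGeemen1994HodgeAV], 3.6 and proof of Lemma 5.2 («isogenies are isomorphisms on `(H₁)_ℚ` which preserve
`End_ℚ`»); D. Mumford [MumfordAV1970], §19 Remark p. 169 (quasi-inverse `g`, `g f = [deg f]`).

## Dictionary

`A` a complex abelian variety of positive dimension with `h ∈ B¹(A) ⊗ ℂ`, `h^{dim A} ≠ 0`, `Q_h` non-degenerate; the
power `A^{n+1} = ⨁_{Fin (n+1)} A` with the product class `Σ πᵢ^* h`; an isogeny `f : A^{n+1} ⟶ Z` with quasi-inverse
`g`, `g ≫ f = k • 𝟙`, `f ≫ g = k • 𝟙`, `k ≠ 0` (or just `AbelianVariety.IsIsogenous Z (⨁ A)`); `F = ℚ(φ) ⊆ End⁰(Z)`,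
`P(φ) = 0`, `P` monic irreducible over `ℚ` of degree `e`, `e · 2m = 2 dim Z`; the transported generator
`f ≫ φ ≫ g ∈ End(A^{n+1})` with `P_k = P.scaleRoots k`; `W_F ⊗ ℂ = weilClassesField Z φ P (2m) ⊆ H^{2m}(Z(ℂ); ℂ)`,
`Bᵐ ⊗ ℂ = hodgeClassSpan Z.dim Z.X m`, `𝒟ᵐ ⊗ ℂ = divisorClassesSpan Z.X Z.dim m`, `n_ρ = eigenMultiplicity Z φ ρ`.
TYPE 4 DATA ON `A` (as in g26-#3): `ψ` central, `R(ψ) = 0` with `R` monic irreducible, Rosati image `ψ'` with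
`N'ψ' ∈ ℤ[ψ]`, `ψ' ≠ ψ`, every central `g₀` with `N g₀ ∈ ℤ[ψ]`.  TYPE 3 DATA ON `A` (as in g23-#5): `ψ` Rosati-symmetric
with `Q(ψ) = 0` (`Q` monic irreducible), `α, β` Rosati-skew with `ψα = αψ`, `ψβ = βψ`, `αβ = -βα`, `α² = a(ψ)`,
`β² = b(ψ)` (`a, b ∈ ℤ[T]` non-vanishing at the roots of `Q`), every `g₀ ∈ End(A)` with `N g₀ ∈ ℤ⟨ψ, α, β⟩`; CENTRE `ℚ`:
`α² = [a]`, `β² = [b]`, `a, b ∈ ℤ ∖ {0}`, every `g₀` with `N g₀ ∈ ℤ⟨1, α, β⟩`.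

## What is proved

* §1 CRITERION (2), TYPE 3, FOR `Z` ISOGENOUS TO `A^{n+1}` (explicit isogeny; the parity read on the power through the
  transported generator): **`weilClassesField_le_divisorClassesSpan_iff_forall_dvd_transport_of_isIsogeny_biproduct_of_definiteQuaternionOver_End`**
  (`W_F(Z) ⊗ ℂ ≤ 𝒟ᵐ ⊗ ℂ` iff every per-place exponent of `(f ≫ φ ≫ g)^*` against `(⊕ψ)^*` is even),
  **`weilClassesField_inf_divisorClassesSpan_eq_bot_iff_exists_odd_transport_…`** (all non-zero classes exceptional iff
  some exponent is odd).
* §2 TYPE 3 OVER `ℚ`, FOR EVERY `Z ∼ A^{n+1}` AND EVERY `F = ℚ(φ) ⊆ End⁰(Z)` — the print's integer «`2m'[E:ℚ]/[F:ℚ]`»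
  needs no transport: **`weilClassesField_le_divisorClassesSpan_iff_dvd_of_isIsogenous_biproduct_of_definiteQuaternion_End`**
  (`W_F(Z) ⊗ ℂ ≤ 𝒟ᵐ(Z) ⊗ ℂ ↔ dim A ∣ m`), **`…_inf_divisorClassesSpan_eq_bot_iff_not_dvd_…`** (`↔ ¬ dim A ∣ m`), and the
  dichotomy `…_le_or_inf_…`.
* §3 «DOES `W_F(Z)` CONSIST OF EXCEPTIONAL HODGE CLASSES?» (Q1 + Q2; Criteria (1)+(2)) FOR `Z ∼ A^{n+1}`:
  **`weilClassesField_le_hodgeClassSpan_and_inf_divisorClassesSpan_eq_bot_iff_transport_of_isIsogeny_biproduct_of_CMCentre_End`**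
  (TYPE 4: `W_F ≤ Bᵐ ∧ W_F ⊓ 𝒟ᵐ = ⊥` iff `n_ρ = n_ρ̄` at every root of `P` AND imbalance of `(⊕ψ)^*`, `(⊕ψ')^*` on some
  eigenspace of the transported generator), the TYPE-4 TRICHOTOMY for every `Z ∼ A^{n+1}`
  (`weilClassesField_not_le_hodgeClassSpan_or_le_divisorClassesSpan_or_of_isIsogenous_biproduct_of_CMCentre_End`),
  **`weilClassesField_le_hodgeClassSpan_and_inf_divisorClassesSpan_eq_bot_iff_not_dvd_of_isIsogenous_biproduct_of_definiteQuaternion_End`**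
  (TYPE 3 OVER `ℚ`: iff `n_ρ = n_ρ̄` at every root AND `dim A ∤ m`), the type-3-over-`ℚ` trichotomy, and the general
  type-3 form `…_iff_exists_odd_transport_…` (explicit isogeny).

## Scope (honest column)

As in the three parent files: «type 3» / «type 4» are the stated `End(A)`-level presentations / centre hypotheses, not
the Albert classification; simplicity of `A` is not used; the parity is per place and per root (it is the print's single
integer `2m[E:ℚ]/[F:ℚ]` when `E ⊆ F` or `E = ℚ` — honest column of `WeilClassesFieldOrthogonalCornersParity`); the type-4
balance is evaluated on the POWER through the transported field (the print's own reduction «we may even assume that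
`X = Y^m`»).  «Hodge class» is read on the complexification: `W_F ⊗ ℂ ≤ Bᵐ ⊗ ℂ` (Deligne's Prop. 4.4 in the lane's form).

## References

* [MoonenZarhin1998WeilClasses] B. J. J. Moonen, Yu. G. Zarhin, Weil classes on abelian varieties, J. reine angew.
  Math. 496 (1998) 83–92; arXiv:alg-geom/9612017: Introduction (chunk p0001 L10–L12, L46–L50), §1 (chunk p0002
  L45–L46), Criterion (1) (section (crit1)), Criterion (2) (chunk p0003 L59–L80) and its proof (L82–L127; p0004 L1–L27).
* [Deligne1982HodgeCycles] P. Deligne, Hodge cycles on abelian varieties, in LNM 900 (1982), Prop. 4.4.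
* [vanGeemen1994HodgeAV] B. van Geemen, An introduction to the Hodge conjecture for abelian varieties, LNM 1594 (1994),
  3.6, Lemma 3.7, proof of Lemma 5.2.
* [MumfordAV1970] D. Mumford, Abelian Varieties (1970), §19 Remark p. 169.
* [Milne1999LefschetzClasses] J. S. Milne, Lefschetz classes on abelian varieties, Duke Math. J. 96 (1999), §1, Thm. 3.2,
  Cor. 4.5.

## Provenance

Lane `lit-hodgefound` (Track 2, Layer A), prover seat `lit-hodgefound-p21` (generation 27), row g27-#2 (the «`X`
isogenous to `Y^m`» forms of g23-#5 and g26-#7).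
-/

noncomputable section

open CategoryTheory CategoryTheory.Limits Polynomial Module
open Literature.AlgebraicTopology.SingularHomology
open Literature.AlgebraicGeometry.Motives
open Literature.AlgebraicGeometry.VanGeemen1994 (hodgeClassSpan pullbackOne)
open Literature.AlgebraicGeometry.Milne1999
open Literature.Barriers.HodgeConjecture (divisorClassesSpan)
open Literature.Geometry.Kaehler (lefschetzPow)

namespace Literature.AlgebraicGeometry.HodgeTheory

open CentralTorus

/-! ### §1 Criterion (2), TYPE 3 (centre `E = ℚ(ψ)`), for `Z` isogenous to `A^{n+1}` through an explicit isogeny -/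

section TypeThree

variable {A Z : AbelianVariety ℂ} {h : complexBetti A.X 2} {n k : ℕ} {ψ α β : A ⟶ A} {qa qb : Polynomial ℤ}
  {f : (⨁ (fun _ : Fin (n + 1) => A)) ⟶ Z} {g : Z ⟶ ⨁ (fun _ : Fin (n + 1) => A)} {φ : Z ⟶ Z}
  {P Q : Polynomial ℤ} {e m : ℕ}

/-- **CRITERION (2), TYPE 3, «`W_F` DECOMPOSABLE ⟺ EVERY EXPONENT EVEN», FOR `Z` ISOGENOUS TO `A^{n+1}`** (`f : A^{n+1} ⟶
Z` an isogeny with quasi-inverse `g`, `g ≫ f = [k]`, `f ≫ g = [k]`, `k ≠ 0`; `End⁰(A) = ℚ⟨ψ, α, β⟩` a definite quaternion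
algebra over `E = ℚ(ψ)` in the `End(A)`-level sense of g23-#5): `W_F(Z) ⊗ ℂ ≤ 𝒟ᵐ(Z) ⊗ ℂ` iff on the power `A^{n+1}`,
for every root `ρ` of `P_k = P.scaleRoots k` and every root `z` of `Q`, `dim ker(ψ^* − z)` divides
`dim(V_ρ(f ≫ φ ≫ g) ∩ ker((⊕ψ)^* − z))`.
[cite: MoonenZarhin1998WeilClasses, §1 («Since everything only depends on X up to isogeny, we may even assume that X = Y^m»; chunk p0002 L45–L46) and Criterion (2), case «Y is of Type 3, m ≥ 2 and the integer 2m·[E:ℚ]/[F:ℚ] is odd», with its proof (chunk p0003 L59–L80, L107–L127; p0004 L1–L27)]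
[cite: vanGeemen1994HodgeAV, 3.6 and proof of Lemma 5.2] [cite: MumfordAV1970, §19 Remark p. 169] -/
theorem weilClassesField_le_divisorClassesSpan_iff_forall_dvd_transport_of_isIsogeny_biproduct_of_definiteQuaternionOver_End
    (hA : 0 < A.dim) (hh : h ∈ hodgeClassSpan A.dim A.X 1) (htop : lefschetzPow h (A.dim - 1) 2 h ≠ 0)
    (hnd : ∀ x : complexBetti A.X 1, (∀ y, polarizationPairingOne A.X h (A.dim - 1) x y = 0) → x = 0)
    (hψsym : ∀ v w : complexBetti A.X 1, polarizationPairingOne A.X h (A.dim - 1) (pullbackOne A ψ v) w =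
      polarizationPairingOne A.X h (A.dim - 1) v (pullbackOne A ψ w))
    (hQm : Q.Monic) (hQirr : Irreducible (Q.map (Int.castRingHom ℚ)))
    (hψQ : Polynomial.eval₂ (Int.castRingHom (CategoryTheory.End A)) (ψ : CategoryTheory.End A) Q = 0)
    (hα2 : α ≫ α = Polynomial.eval₂ (Int.castRingHom (CategoryTheory.End A)) (ψ : CategoryTheory.End A) qa)
    (hqa : ∀ z : ℂ, (Q.map (Int.castRingHom ℂ)).IsRoot z → (qa.map (Int.castRingHom ℂ)).eval z ≠ 0)
    (hβ2 : β ≫ β = Polynomial.eval₂ (Int.castRingHom (CategoryTheory.End A)) (ψ : CategoryTheory.End A) qb)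
    (hqb : ∀ z : ℂ, (Q.map (Int.castRingHom ℂ)).IsRoot z → (qb.map (Int.castRingHom ℂ)).eval z ≠ 0)
    (hanti : α ≫ β = -(β ≫ α))
    (hαskew : ∀ v w : complexBetti A.X 1, polarizationPairingOne A.X h (A.dim - 1) (pullbackOne A α v) w =
      -polarizationPairingOne A.X h (A.dim - 1) v (pullbackOne A α w))
    (hβskew : ∀ v w : complexBetti A.X 1, polarizationPairingOne A.X h (A.dim - 1) (pullbackOne A β v) w =
      -polarizationPairingOne A.X h (A.dim - 1) v (pullbackOne A β w))
    (hψα : ψ ≫ α = α ≫ ψ) (hψβ : ψ ≫ β = β ≫ ψ)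
    (hD : ∀ g₀ : A ⟶ A, ∃ N : ℤ, N ≠ 0 ∧ End.of (N • g₀) ∈ Subring.closure {End.of ψ, End.of α, End.of β})
    (hf : AbelianVariety.IsIsogeny f) (hgf : g ≫ f = k • 𝟙 Z) (hfg : f ≫ g = k • 𝟙 (⨁ (fun _ : Fin (n + 1) => A)))
    (hk : k ≠ 0) (hPm : P.Monic) (hPe : P.natDegree = e) (hPirr : Irreducible (P.map (Int.castRingHom ℚ)))
    (hφ : Polynomial.eval₂ (Int.castRingHom (CategoryTheory.End Z)) (End.of φ) P = 0)
    (her : e * (2 * m) = 2 * Z.dim) :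
    weilClassesField Z φ P (2 * m) ≤ divisorClassesSpan Z.X Z.dim m ↔
      ∀ ρ : ℂ, Polynomial.eval₂ (Int.castRingHom ℂ) ρ (P.scaleRoots (k : ℤ)) = 0 →
        ∀ z : ℂ, (Q.map (Int.castRingHom ℂ)).IsRoot z →
          Module.finrank ℂ ↥((pullbackOne A ψ).eigenspace z) ∣
            Module.finrank ℂ ↥((pullbackOne (⨁ (fun _ : Fin (n + 1) => A)) (f ≫ φ ≫ g)).eigenspace ρ ⊓
              (pullbackOne (⨁ (fun _ : Fin (n + 1) => A)) (biproduct.map fun _ : Fin (n + 1) => ψ)).eigenspace z) := by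
  have hPmX : (P.scaleRoots (k : ℤ)).Monic := (Polynomial.monic_scaleRoots_iff (k : ℤ)).2 hPm
  have hPeX : (P.scaleRoots (k : ℤ)).natDegree = e := by rw [Polynomial.natDegree_scaleRoots, hPe]
  have hPirrX := irreducible_map_scaleRoots_natCast hPirr hk
  have hφX := eval₂_transport_scaleRoots_eq_zero hgf hfg hk hφ
  have herX : e * (2 * m) = 2 * ((n + 1) * A.dim) := by
    rw [her, ← AbelianVariety.dim_eq_of_isIsogeny hf, dim_biproduct_const_succ]
  rw [← weilClassesField_transport_le_divisorClassesSpan_iff hf hgf hk hPirr hφ m]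
  exact weilClassesField_biproduct_le_divisorClassesSpan_iff_forall_dvd_of_definiteQuaternionOver_End hA hh htop hnd hψsym
    hQm hQirr hψQ hα2 hqa hβ2 hqb hanti hαskew hβskew hψα hψβ hD hPmX hPeX hPirrX hφX herX

/-- **CRITERION (2), TYPE 3, «ALL NON-ZERO CLASSES EXCEPTIONAL ⟺ SOME EXPONENT ODD», FOR `Z` ISOGENOUS TO `A^{n+1}`**:
`W_F(Z) ⊗ ℂ ⊓ 𝒟ᵐ(Z) ⊗ ℂ = ⊥` iff at some root `ρ` of `P_k` and some root `z` of `Q`,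
`2 dim(V_ρ(f ≫ φ ≫ g) ∩ ker((⊕ψ)^* − z))` is an odd multiple of `dim ker(ψ^* − z)`.
[cite: MoonenZarhin1998WeilClasses, §1 (chunk p0002 L45–L46) and Criterion (2), case «Y is of Type 3, m ≥ 2 and the integer 2m·[E:ℚ]/[F:ℚ] is odd», with its proof (chunk p0003 L59–L80, L107–L127; p0004 L1–L27)]
[cite: vanGeemen1994HodgeAV, 3.6 and proof of Lemma 5.2] [cite: MumfordAV1970, §19 Remark p. 169] -/
theorem weilClassesField_inf_divisorClassesSpan_eq_bot_iff_exists_odd_transport_of_isIsogeny_biproduct_of_definiteQuaternionOver_End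
    (hA : 0 < A.dim) (hh : h ∈ hodgeClassSpan A.dim A.X 1) (htop : lefschetzPow h (A.dim - 1) 2 h ≠ 0)
    (hnd : ∀ x : complexBetti A.X 1, (∀ y, polarizationPairingOne A.X h (A.dim - 1) x y = 0) → x = 0)
    (hψsym : ∀ v w : complexBetti A.X 1, polarizationPairingOne A.X h (A.dim - 1) (pullbackOne A ψ v) w =
      polarizationPairingOne A.X h (A.dim - 1) v (pullbackOne A ψ w))
    (hQm : Q.Monic) (hQirr : Irreducible (Q.map (Int.castRingHom ℚ)))
    (hψQ : Polynomial.eval₂ (Int.castRingHom (CategoryTheory.End A)) (ψ : CategoryTheory.End A) Q = 0)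
    (hα2 : α ≫ α = Polynomial.eval₂ (Int.castRingHom (CategoryTheory.End A)) (ψ : CategoryTheory.End A) qa)
    (hqa : ∀ z : ℂ, (Q.map (Int.castRingHom ℂ)).IsRoot z → (qa.map (Int.castRingHom ℂ)).eval z ≠ 0)
    (hβ2 : β ≫ β = Polynomial.eval₂ (Int.castRingHom (CategoryTheory.End A)) (ψ : CategoryTheory.End A) qb)
    (hqb : ∀ z : ℂ, (Q.map (Int.castRingHom ℂ)).IsRoot z → (qb.map (Int.castRingHom ℂ)).eval z ≠ 0)
    (hanti : α ≫ β = -(β ≫ α))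
    (hαskew : ∀ v w : complexBetti A.X 1, polarizationPairingOne A.X h (A.dim - 1) (pullbackOne A α v) w =
      -polarizationPairingOne A.X h (A.dim - 1) v (pullbackOne A α w))
    (hβskew : ∀ v w : complexBetti A.X 1, polarizationPairingOne A.X h (A.dim - 1) (pullbackOne A β v) w =
      -polarizationPairingOne A.X h (A.dim - 1) v (pullbackOne A β w))
    (hψα : ψ ≫ α = α ≫ ψ) (hψβ : ψ ≫ β = β ≫ ψ)
    (hD : ∀ g₀ : A ⟶ A, ∃ N : ℤ, N ≠ 0 ∧ End.of (N • g₀) ∈ Subring.closure {End.of ψ, End.of α, End.of β})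
    (hf : AbelianVariety.IsIsogeny f) (hgf : g ≫ f = k • 𝟙 Z) (hfg : f ≫ g = k • 𝟙 (⨁ (fun _ : Fin (n + 1) => A)))
    (hk : k ≠ 0) (hPm : P.Monic) (hPe : P.natDegree = e) (hPirr : Irreducible (P.map (Int.castRingHom ℚ)))
    (hφ : Polynomial.eval₂ (Int.castRingHom (CategoryTheory.End Z)) (End.of φ) P = 0)
    (her : e * (2 * m) = 2 * Z.dim) :
    weilClassesField Z φ P (2 * m) ⊓ divisorClassesSpan Z.X Z.dim m = ⊥ ↔
      ∃ ρ : ℂ, Polynomial.eval₂ (Int.castRingHom ℂ) ρ (P.scaleRoots (k : ℤ)) = 0 ∧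
        ∃ z : ℂ, (Q.map (Int.castRingHom ℂ)).IsRoot z ∧
          ∃ j : ℕ, 2 * Module.finrank ℂ ↥((pullbackOne (⨁ (fun _ : Fin (n + 1) => A)) (f ≫ φ ≫ g)).eigenspace ρ ⊓
              (pullbackOne (⨁ (fun _ : Fin (n + 1) => A)) (biproduct.map fun _ : Fin (n + 1) => ψ)).eigenspace z) =
            (2 * j + 1) * Module.finrank ℂ ↥((pullbackOne A ψ).eigenspace z) := by
  have hPmX : (P.scaleRoots (k : ℤ)).Monic := (Polynomial.monic_scaleRoots_iff (k : ℤ)).2 hPm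
  have hPeX : (P.scaleRoots (k : ℤ)).natDegree = e := by rw [Polynomial.natDegree_scaleRoots, hPe]
  have hPirrX := irreducible_map_scaleRoots_natCast hPirr hk
  have hφX := eval₂_transport_scaleRoots_eq_zero hgf hfg hk hφ
  have herX : e * (2 * m) = 2 * ((n + 1) * A.dim) := by
    rw [her, ← AbelianVariety.dim_eq_of_isIsogeny hf, dim_biproduct_const_succ]
  rw [← weilClassesField_transport_inf_divisorClassesSpan_eq_bot_iff hf hgf hk hPirr hφ m]
  exact weilClassesField_biproduct_inf_divisorClassesSpan_eq_bot_iff_exists_odd_of_definiteQuaternionOver_End hA hh htop hnd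
    hψsym hQm hQirr hψQ hα2 hqa hβ2 hqb hanti hαskew hβskew hψα hψβ hD hPmX hPeX hPirrX hφX herX

end TypeThree

/-! ### §2 Criterion (2), TYPE 3 OVER `ℚ`, for EVERY `Z ∼ A^{n+1}` and every `F = ℚ(φ) ⊆ End⁰(Z)`: «decomposable ⟺ `dim A ∣ m`» -/

section TypeThreeRat

variable {A Z : AbelianVariety ℂ} {h : complexBetti A.X 2} {n : ℕ} {α β : A ⟶ A} {a b : ℤ} {φ : Z ⟶ Z}
  {P : Polynomial ℤ} {e m : ℕ}

/-- **CRITERION (2), TYPE 3 OVER `ℚ`: `W_F(Z) ⊗ ℂ ≤ 𝒟ᵐ(Z) ⊗ ℂ ↔ dim A ∣ m` FOR EVERY `Z` ISOGENOUS TO `A^{n+1}`**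
(`End⁰(A) = ℚ⟨α, β⟩` a definite quaternion algebra over `ℚ` in the `End(A)`-level sense: `α, β` Rosati-skew,
`αβ = -βα`, `α² = [a]`, `β² = [b]`, `a, b ≠ 0`, every `g₀ ∈ End(A)` with `N g₀ ∈ ℤ⟨1, α, β⟩`) and every
`F = ℚ(φ) ⊆ End⁰(Z)` with `[F:ℚ] · 2m = 2 dim Z` — the print's «`W_F` consists of decomposable Hodge classes if and only
if the integer `2m'[E:ℚ]/[F:ℚ]` is even», `E = ℚ`, `m' = n + 1`, read up to isogeny (the transported field has the same
degree, so the parity statement is unchanged).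
[cite: MoonenZarhin1998WeilClasses, §1 (chunk p0002 L45–L46) and Criterion (2), case «Y is of Type 3, m ≥ 2», proof (chunk p0004 L25–L27 «W_F consists of decomposable Hodge classes if and only if the integer 2m[E:ℚ]/[F:ℚ] is even»)]
[cite: vanGeemen1994HodgeAV, 3.6 and proof of Lemma 5.2] [cite: MumfordAV1970, §19 Remark p. 169] -/
theorem weilClassesField_le_divisorClassesSpan_iff_dvd_of_isIsogenous_biproduct_of_definiteQuaternion_End
    (hA : 0 < A.dim) (hh : h ∈ hodgeClassSpan A.dim A.X 1) (htop : lefschetzPow h (A.dim - 1) 2 h ≠ 0)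
    (hnd : ∀ x : complexBetti A.X 1, (∀ y, polarizationPairingOne A.X h (A.dim - 1) x y = 0) → x = 0)
    (ha : a ≠ 0) (hα2 : α ≫ α = a • 𝟙 A) (hb : b ≠ 0) (hβ2 : β ≫ β = b • 𝟙 A) (hanti : α ≫ β = -(β ≫ α))
    (hαskew : ∀ v w : complexBetti A.X 1, polarizationPairingOne A.X h (A.dim - 1) (pullbackOne A α v) w =
      -polarizationPairingOne A.X h (A.dim - 1) v (pullbackOne A α w))
    (hβskew : ∀ v w : complexBetti A.X 1, polarizationPairingOne A.X h (A.dim - 1) (pullbackOne A β v) w =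
      -polarizationPairingOne A.X h (A.dim - 1) v (pullbackOne A β w))
    (hD : ∀ g₀ : A ⟶ A, ∃ N : ℤ, N ≠ 0 ∧ End.of (N • g₀) ∈ Subring.closure {End.of (𝟙 A), End.of α, End.of β})
    (hZA : AbelianVariety.IsIsogenous Z (⨁ (fun _ : Fin (n + 1) => A)))
    (hPm : P.Monic) (hPe : P.natDegree = e) (hPirr : Irreducible (P.map (Int.castRingHom ℚ)))
    (hφ : Polynomial.eval₂ (Int.castRingHom (CategoryTheory.End Z)) (End.of φ) P = 0)
    (her : e * (2 * m) = 2 * Z.dim) :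
    weilClassesField Z φ P (2 * m) ≤ divisorClassesSpan Z.X Z.dim m ↔ A.dim ∣ m := by
  obtain ⟨φ', P', hP'm, hP'e, hP'irr, hφ', hdim, hiff⟩ :=
    exists_transport_decomposable_iff_of_isIsogenous' hZA hPm hPirr hφ
  have herX : e * (2 * m) = 2 * ((n + 1) * A.dim) := by rw [her, ← hdim, dim_biproduct_const_succ]
  rw [← (hiff m).1]
  exact weilClassesField_biproduct_le_divisorClassesSpan_iff_dvd_of_definiteQuaternion_End hA hh htop hnd ha hα2 hb hβ2
    hanti hαskew hβskew hD hP'm (hP'e.trans hPe) hP'irr hφ' herX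

/-- **… AND `W_F(Z) ⊗ ℂ ⊓ 𝒟ᵐ(Z) ⊗ ℂ = ⊥ ↔ dim A ∤ m`** («`2m'/[F:ℚ]` odd»: all non-zero Weil classes exceptional), for
every `Z ∼ A^{n+1}`. [cite: MoonenZarhin1998WeilClasses, §1 (chunk p0002 L45–L46) and Criterion (2), case «Y is of Type 3, m ≥ 2 and the integer 2m·[E:ℚ]/[F:ℚ] is odd» (chunk p0003 L59–L80)]
[cite: vanGeemen1994HodgeAV, 3.6 and proof of Lemma 5.2] [cite: MumfordAV1970, §19 Remark p. 169] -/
theorem weilClassesField_inf_divisorClassesSpan_eq_bot_iff_not_dvd_of_isIsogenous_biproduct_of_definiteQuaternion_End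
    (hA : 0 < A.dim) (hh : h ∈ hodgeClassSpan A.dim A.X 1) (htop : lefschetzPow h (A.dim - 1) 2 h ≠ 0)
    (hnd : ∀ x : complexBetti A.X 1, (∀ y, polarizationPairingOne A.X h (A.dim - 1) x y = 0) → x = 0)
    (ha : a ≠ 0) (hα2 : α ≫ α = a • 𝟙 A) (hb : b ≠ 0) (hβ2 : β ≫ β = b • 𝟙 A) (hanti : α ≫ β = -(β ≫ α))
    (hαskew : ∀ v w : complexBetti A.X 1, polarizationPairingOne A.X h (A.dim - 1) (pullbackOne A α v) w =
      -polarizationPairingOne A.X h (A.dim - 1) v (pullbackOne A α w))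
    (hβskew : ∀ v w : complexBetti A.X 1, polarizationPairingOne A.X h (A.dim - 1) (pullbackOne A β v) w =
      -polarizationPairingOne A.X h (A.dim - 1) v (pullbackOne A β w))
    (hD : ∀ g₀ : A ⟶ A, ∃ N : ℤ, N ≠ 0 ∧ End.of (N • g₀) ∈ Subring.closure {End.of (𝟙 A), End.of α, End.of β})
    (hZA : AbelianVariety.IsIsogenous Z (⨁ (fun _ : Fin (n + 1) => A)))
    (hPm : P.Monic) (hPe : P.natDegree = e) (hPirr : Irreducible (P.map (Int.castRingHom ℚ)))
    (hφ : Polynomial.eval₂ (Int.castRingHom (CategoryTheory.End Z)) (End.of φ) P = 0)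
    (her : e * (2 * m) = 2 * Z.dim) :
    weilClassesField Z φ P (2 * m) ⊓ divisorClassesSpan Z.X Z.dim m = ⊥ ↔ ¬ A.dim ∣ m := by
  obtain ⟨φ', P', hP'm, hP'e, hP'irr, hφ', hdim, hiff⟩ :=
    exists_transport_decomposable_iff_of_isIsogenous' hZA hPm hPirr hφ
  have herX : e * (2 * m) = 2 * ((n + 1) * A.dim) := by rw [her, ← hdim, dim_biproduct_const_succ]
  rw [← (hiff m).2]
  exact weilClassesField_biproduct_inf_divisorClassesSpan_eq_bot_iff_not_dvd_of_definiteQuaternion_End hA hh htop hnd ha hα2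
    hb hβ2 hanti hαskew hβskew hD hP'm (hP'e.trans hPe) hP'irr hφ' herX

/-- **THE DICHOTOMY AS PRINTED, TYPE 3 OVER `ℚ`, FOR EVERY `Z ∼ A^{n+1}`**: «either all classes in `W_F` are decomposable,
or all non-zero classes in `W_F` are exceptional» — by `dim A ∣ m ∨ dim A ∤ m`.
[cite: MoonenZarhin1998WeilClasses, §1 Criterion (2), first assertion (chunk p0003 L59–L67), type 3] -/
theorem weilClassesField_le_or_inf_divisorClassesSpan_eq_bot_of_isIsogenous_biproduct_of_definiteQuaternion_End
    (hA : 0 < A.dim) (hh : h ∈ hodgeClassSpan A.dim A.X 1) (htop : lefschetzPow h (A.dim - 1) 2 h ≠ 0)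
    (hnd : ∀ x : complexBetti A.X 1, (∀ y, polarizationPairingOne A.X h (A.dim - 1) x y = 0) → x = 0)
    (ha : a ≠ 0) (hα2 : α ≫ α = a • 𝟙 A) (hb : b ≠ 0) (hβ2 : β ≫ β = b • 𝟙 A) (hanti : α ≫ β = -(β ≫ α))
    (hαskew : ∀ v w : complexBetti A.X 1, polarizationPairingOne A.X h (A.dim - 1) (pullbackOne A α v) w =
      -polarizationPairingOne A.X h (A.dim - 1) v (pullbackOne A α w))
    (hβskew : ∀ v w : complexBetti A.X 1, polarizationPairingOne A.X h (A.dim - 1) (pullbackOne A β v) w =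
      -polarizationPairingOne A.X h (A.dim - 1) v (pullbackOne A β w))
    (hD : ∀ g₀ : A ⟶ A, ∃ N : ℤ, N ≠ 0 ∧ End.of (N • g₀) ∈ Subring.closure {End.of (𝟙 A), End.of α, End.of β})
    (hZA : AbelianVariety.IsIsogenous Z (⨁ (fun _ : Fin (n + 1) => A)))
    (hPm : P.Monic) (hPe : P.natDegree = e) (hPirr : Irreducible (P.map (Int.castRingHom ℚ)))
    (hφ : Polynomial.eval₂ (Int.castRingHom (CategoryTheory.End Z)) (End.of φ) P = 0)
    (her : e * (2 * m) = 2 * Z.dim) :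
    weilClassesField Z φ P (2 * m) ≤ divisorClassesSpan Z.X Z.dim m ∨
      weilClassesField Z φ P (2 * m) ⊓ divisorClassesSpan Z.X Z.dim m = ⊥ := by
  by_cases hdvd : A.dim ∣ m
  · exact Or.inl ((weilClassesField_le_divisorClassesSpan_iff_dvd_of_isIsogenous_biproduct_of_definiteQuaternion_End hA hh
      htop hnd ha hα2 hb hβ2 hanti hαskew hβskew hD hZA hPm hPe hPirr hφ her).2 hdvd)
  · exact Or.inr ((weilClassesField_inf_divisorClassesSpan_eq_bot_iff_not_dvd_of_isIsogenous_biproduct_of_definiteQuaternion_End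
      hA hh htop hnd ha hα2 hb hβ2 hanti hαskew hβskew hD hZA hPm hPe hPirr hφ her).2 hdvd)

end TypeThreeRat

/-! ### §3 «Does `W_F(Z)` consist of exceptional Hodge classes?» — Criteria (1)+(2) assembled for `Z ∼ A^{n+1}`, types 4 and 3 -/

section ExceptionalHodge

variable {A Z : AbelianVariety ℂ} {h : complexBetti A.X 2} {n k : ℕ} {ψ ψ' α β : A ⟶ A} {qa qb : Polynomial ℤ}
  {a b : ℤ} {f : (⨁ (fun _ : Fin (n + 1) => A)) ⟶ Z} {g : Z ⟶ ⨁ (fun _ : Fin (n + 1) => A)} {φ : Z ⟶ Z}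
  {P Q R : Polynomial ℤ} {e m : ℕ}

/-- **EXCEPTIONAL WEIL–HODGE CLASSES, TYPE 4, FOR `Z` ISOGENOUS TO `A^{n+1}`, FROM `End(A)`** (explicit isogeny
`f : A^{n+1} ⟶ Z`, `g ≫ f = [k]`, `f ≫ g = [k]`, `k ≠ 0`; `A` with CM centre `E = ℚ(ψ)` in the `End(A)`-level sense of
g26-#3): `W_F(Z) ⊗ ℂ` consists of Hodge classes all of whose non-zero members are exceptional — `W_F ⊗ ℂ ≤ Bᵐ ⊗ ℂ` and
`W_F ⊗ ℂ ⊓ 𝒟ᵐ ⊗ ℂ = ⊥` — IFF `n_ρ = n_ρ̄` at every complex root `ρ` of `P` (Criterion (1), on `Z`) AND on the power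
`A^{n+1}`, at some root `ρ` of `P_k` and some `σ`, the multiplicities of `σ` for `(⊕ψ)^*` and `(⊕ψ')^*` on the eigenspace
`V_ρ(f ≫ φ ≫ g)` differ (Criterion (2), «`θ ≠ 0`», read on the power).
[cite: MoonenZarhin1998WeilClasses, Introduction Q1–Q2 (chunk p0001 L46–L50), §1 (chunk p0002 L45–L46), Criterion (1) (section (crit1)) and Criterion (2), cases «Type 4» (chunk p0003 L59–L80, L92–L106)]
[cite: Deligne1982HodgeCycles, Prop. 4.4] [cite: vanGeemen1994HodgeAV, 3.6 and proof of Lemma 5.2] [cite: MumfordAV1970, §19 Remark p. 169] -/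
theorem weilClassesField_le_hodgeClassSpan_and_inf_divisorClassesSpan_eq_bot_iff_transport_of_isIsogeny_biproduct_of_CMCentre_End
    (hA : 0 < A.dim) (hh : h ∈ hodgeClassSpan A.dim A.X 1) (htop : lefschetzPow h (A.dim - 1) 2 h ≠ 0)
    (hnd : ∀ x : complexBetti A.X 1, (∀ y, polarizationPairingOne A.X h (A.dim - 1) x y = 0) → x = 0)
    (hψ : ∀ χ : A ⟶ A, ψ ≫ χ = χ ≫ ψ) (hRm : R.Monic) (hRirr : Irreducible (R.map (Int.castRingHom ℚ)))
    (hψR : Polynomial.eval₂ (Int.castRingHom (CategoryTheory.End A)) (ψ : CategoryTheory.End A) R = 0)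
    (hadj : ∀ x y : complexBetti A.X 1, polarizationPairingOne A.X h (A.dim - 1) (pullbackOne A ψ x) y =
      polarizationPairingOne A.X h (A.dim - 1) x (pullbackOne A ψ' y))
    (hψ'E : ∃ N : ℤ, N ≠ 0 ∧ End.of (N • ψ') ∈ Subring.closure {End.of ψ}) (hne : ψ' ≠ ψ)
    (hZ : ∀ g₀ : A ⟶ A, (∀ χ : A ⟶ A, g₀ ≫ χ = χ ≫ g₀) →
      ∃ N : ℤ, N ≠ 0 ∧ End.of (N • g₀) ∈ Subring.closure {End.of ψ})
    (hf : AbelianVariety.IsIsogeny f) (hgf : g ≫ f = k • 𝟙 Z) (hfg : f ≫ g = k • 𝟙 (⨁ (fun _ : Fin (n + 1) => A)))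
    (hk : k ≠ 0) (hPm : P.Monic) (hPe : P.natDegree = e) (hPirr : Irreducible (P.map (Int.castRingHom ℚ)))
    (hφ : Polynomial.eval₂ (Int.castRingHom (CategoryTheory.End Z)) (End.of φ) P = 0)
    (her : e * (2 * m) = 2 * Z.dim) (hm : m ≠ 0) :
    (weilClassesField Z φ P (2 * m) ≤ hodgeClassSpan Z.dim Z.X m ∧
        weilClassesField Z φ P (2 * m) ⊓ divisorClassesSpan Z.X Z.dim m = ⊥) ↔
      (∀ ρ : ℂ, Polynomial.eval₂ (Int.castRingHom ℂ) ρ P = 0 →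
          eigenMultiplicity Z φ ρ = eigenMultiplicity Z φ (starRingEnd ℂ ρ)) ∧
        ∃ ρ σ : ℂ, Polynomial.eval₂ (Int.castRingHom ℂ) ρ (P.scaleRoots (k : ℤ)) = 0 ∧
          Module.finrank ℂ ↥((pullbackOne (⨁ (fun _ : Fin (n + 1) => A)) (f ≫ φ ≫ g)).eigenspace ρ ⊓
              (pullbackOne (⨁ (fun _ : Fin (n + 1) => A)) (biproduct.map fun _ : Fin (n + 1) => ψ)).eigenspace σ) ≠
            Module.finrank ℂ ↥((pullbackOne (⨁ (fun _ : Fin (n + 1) => A)) (f ≫ φ ≫ g)).eigenspace ρ ⊓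
              (pullbackOne (⨁ (fun _ : Fin (n + 1) => A)) (biproduct.map fun _ : Fin (n + 1) => ψ')).eigenspace σ) := by
  rw [Deligne1982.weilClassesField_le_hodgeClassSpan_iff_forall_eigenMultiplicity_eq hPm hPe hPirr hφ her,
    weilClassesField_inf_divisorClassesSpan_eq_bot_iff_exists_finrank_ne_transport_of_isIsogeny_biproduct_of_CMCentre_End hA hh
      htop hnd hψ hRm hRirr hψR hadj hψ'E hne hZ hf hgf hfg hk hPm hPe hPirr hφ her hm]

/-- **THE TRICHOTOMY FOR `W_F(Z)`, TYPE 4, FOR EVERY `Z ∼ A^{n+1}`** (`AbelianVariety.IsIsogenous Z (⨁ A)`): `W_F ⊗ ℂ` is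
not contained in the Hodge classes, or it consists of decomposable classes, or it consists of Hodge classes all of whose
non-zero members are exceptional («Then either all classes in `W_F` are decomposable, or all non-zero classes in `W_F`
are exceptional»). [cite: MoonenZarhin1998WeilClasses, Introduction Q1–Q2 (chunk p0001 L46–L50) and §1 Criterion (2), first assertion (chunk p0003 L59–L67), type 4]
[cite: MumfordAV1970, §19 Remark p. 169] -/
theorem weilClassesField_not_le_hodgeClassSpan_or_le_divisorClassesSpan_or_of_isIsogenous_biproduct_of_CMCentre_End
    (hA : 0 < A.dim) (hh : h ∈ hodgeClassSpan A.dim A.X 1) (htop : lefschetzPow h (A.dim - 1) 2 h ≠ 0)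
    (hnd : ∀ x : complexBetti A.X 1, (∀ y, polarizationPairingOne A.X h (A.dim - 1) x y = 0) → x = 0)
    (hψ : ∀ χ : A ⟶ A, ψ ≫ χ = χ ≫ ψ) (hRm : R.Monic) (hRirr : Irreducible (R.map (Int.castRingHom ℚ)))
    (hψR : Polynomial.eval₂ (Int.castRingHom (CategoryTheory.End A)) (ψ : CategoryTheory.End A) R = 0)
    (hadj : ∀ x y : complexBetti A.X 1, polarizationPairingOne A.X h (A.dim - 1) (pullbackOne A ψ x) y =
      polarizationPairingOne A.X h (A.dim - 1) x (pullbackOne A ψ' y))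
    (hψ'E : ∃ N : ℤ, N ≠ 0 ∧ End.of (N • ψ') ∈ Subring.closure {End.of ψ}) (hne : ψ' ≠ ψ)
    (hZ : ∀ g₀ : A ⟶ A, (∀ χ : A ⟶ A, g₀ ≫ χ = χ ≫ g₀) →
      ∃ N : ℤ, N ≠ 0 ∧ End.of (N • g₀) ∈ Subring.closure {End.of ψ})
    (hZA : AbelianVariety.IsIsogenous Z (⨁ (fun _ : Fin (n + 1) => A)))
    (hPm : P.Monic) (hPe : P.natDegree = e) (hPirr : Irreducible (P.map (Int.castRingHom ℚ)))
    (hφ : Polynomial.eval₂ (Int.castRingHom (CategoryTheory.End Z)) (End.of φ) P = 0)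
    (her : e * (2 * m) = 2 * Z.dim) (hm : m ≠ 0) :
    ¬ weilClassesField Z φ P (2 * m) ≤ hodgeClassSpan Z.dim Z.X m ∨
      weilClassesField Z φ P (2 * m) ≤ divisorClassesSpan Z.X Z.dim m ∨
      (weilClassesField Z φ P (2 * m) ≤ hodgeClassSpan Z.dim Z.X m ∧
        weilClassesField Z φ P (2 * m) ⊓ divisorClassesSpan Z.X Z.dim m = ⊥) := by
  by_cases hH : weilClassesField Z φ P (2 * m) ≤ hodgeClassSpan Z.dim Z.X m
  · rcases weilClassesField_le_or_inf_divisorClassesSpan_eq_bot_of_isIsogenous_biproduct'_of_CMCentre_End hA hh htop hnd hψ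
        hRm hRirr hψR hadj hψ'E hne hZ hZA hPm hPe hPirr hφ her hm with hD | hE
    · exact Or.inr (Or.inl hD)
    · exact Or.inr (Or.inr ⟨hH, hE⟩)
  · exact Or.inl hH

/-- **EXCEPTIONAL WEIL–HODGE CLASSES, TYPE 3 OVER `ℚ`, FOR EVERY `Z` ISOGENOUS TO `A^{n+1}`, FROM `End(A)`**
(`End⁰(A) = ℚ⟨α, β⟩` a definite quaternion algebra over `ℚ` in the `End(A)`-level sense): `W_F(Z) ⊗ ℂ` consists of Hodge
classes all of whose non-zero members are exceptional IFF `n_ρ = n_ρ̄` at every root of `P` (Criterion (1)) AND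
`dim A ∤ m` (Criterion (2), «`2m'[E:ℚ]/[F:ℚ]` odd», `E = ℚ`).
[cite: MoonenZarhin1998WeilClasses, Introduction Q1–Q2 (chunk p0001 L46–L50), §1 (chunk p0002 L45–L46), Criterion (1) (section (crit1)) and Criterion (2), case «Y is of Type 3, m ≥ 2 and the integer 2m·[E:ℚ]/[F:ℚ] is odd» (chunk p0003 L59–L80)]
[cite: Deligne1982HodgeCycles, Prop. 4.4] [cite: vanGeemen1994HodgeAV, 3.6 and proof of Lemma 5.2] [cite: MumfordAV1970, §19 Remark p. 169] -/
theorem weilClassesField_le_hodgeClassSpan_and_inf_divisorClassesSpan_eq_bot_iff_not_dvd_of_isIsogenous_biproduct_of_definiteQuaternion_End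
    (hA : 0 < A.dim) (hh : h ∈ hodgeClassSpan A.dim A.X 1) (htop : lefschetzPow h (A.dim - 1) 2 h ≠ 0)
    (hnd : ∀ x : complexBetti A.X 1, (∀ y, polarizationPairingOne A.X h (A.dim - 1) x y = 0) → x = 0)
    (ha : a ≠ 0) (hα2 : α ≫ α = a • 𝟙 A) (hb : b ≠ 0) (hβ2 : β ≫ β = b • 𝟙 A) (hanti : α ≫ β = -(β ≫ α))
    (hαskew : ∀ v w : complexBetti A.X 1, polarizationPairingOne A.X h (A.dim - 1) (pullbackOne A α v) w =
      -polarizationPairingOne A.X h (A.dim - 1) v (pullbackOne A α w))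
    (hβskew : ∀ v w : complexBetti A.X 1, polarizationPairingOne A.X h (A.dim - 1) (pullbackOne A β v) w =
      -polarizationPairingOne A.X h (A.dim - 1) v (pullbackOne A β w))
    (hD : ∀ g₀ : A ⟶ A, ∃ N : ℤ, N ≠ 0 ∧ End.of (N • g₀) ∈ Subring.closure {End.of (𝟙 A), End.of α, End.of β})
    (hZA : AbelianVariety.IsIsogenous Z (⨁ (fun _ : Fin (n + 1) => A)))
    (hPm : P.Monic) (hPe : P.natDegree = e) (hPirr : Irreducible (P.map (Int.castRingHom ℚ)))
    (hφ : Polynomial.eval₂ (Int.castRingHom (CategoryTheory.End Z)) (End.of φ) P = 0)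
    (her : e * (2 * m) = 2 * Z.dim) :
    (weilClassesField Z φ P (2 * m) ≤ hodgeClassSpan Z.dim Z.X m ∧
        weilClassesField Z φ P (2 * m) ⊓ divisorClassesSpan Z.X Z.dim m = ⊥) ↔
      (∀ ρ : ℂ, Polynomial.eval₂ (Int.castRingHom ℂ) ρ P = 0 →
          eigenMultiplicity Z φ ρ = eigenMultiplicity Z φ (starRingEnd ℂ ρ)) ∧ ¬ A.dim ∣ m := by
  rw [Deligne1982.weilClassesField_le_hodgeClassSpan_iff_forall_eigenMultiplicity_eq hPm hPe hPirr hφ her,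
    weilClassesField_inf_divisorClassesSpan_eq_bot_iff_not_dvd_of_isIsogenous_biproduct_of_definiteQuaternion_End hA hh htop
      hnd ha hα2 hb hβ2 hanti hαskew hβskew hD hZA hPm hPe hPirr hφ her]

/-- **DECOMPOSABLE (HENCE HODGE AND ALGEBRAIC) WEIL CLASSES, TYPE 3 OVER `ℚ`, FOR EVERY `Z ∼ A^{n+1}`**: `W_F(Z) ⊗ ℂ`
consists of Hodge classes and is contained in `𝒟ᵐ ⊗ ℂ` IFF `n_ρ = n_ρ̄` at every root of `P` AND `dim A ∣ m` — the
other Hodge alternative of the trichotomy. [cite: MoonenZarhin1998WeilClasses, Introduction (chunk p0001 L10–L14 «the decomposable classes are algebraic») and §1 Criterion (2), case «Type 3, m ≥ 2» (chunk p0003 L59–L80; p0004 L25–L27)]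
[cite: Deligne1982HodgeCycles, Prop. 4.4] -/
theorem weilClassesField_le_hodgeClassSpan_and_le_divisorClassesSpan_iff_dvd_of_isIsogenous_biproduct_of_definiteQuaternion_End
    (hA : 0 < A.dim) (hh : h ∈ hodgeClassSpan A.dim A.X 1) (htop : lefschetzPow h (A.dim - 1) 2 h ≠ 0)
    (hnd : ∀ x : complexBetti A.X 1, (∀ y, polarizationPairingOne A.X h (A.dim - 1) x y = 0) → x = 0)
    (ha : a ≠ 0) (hα2 : α ≫ α = a • 𝟙 A) (hb : b ≠ 0) (hβ2 : β ≫ β = b • 𝟙 A) (hanti : α ≫ β = -(β ≫ α))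
    (hαskew : ∀ v w : complexBetti A.X 1, polarizationPairingOne A.X h (A.dim - 1) (pullbackOne A α v) w =
      -polarizationPairingOne A.X h (A.dim - 1) v (pullbackOne A α w))
    (hβskew : ∀ v w : complexBetti A.X 1, polarizationPairingOne A.X h (A.dim - 1) (pullbackOne A β v) w =
      -polarizationPairingOne A.X h (A.dim - 1) v (pullbackOne A β w))
    (hD : ∀ g₀ : A ⟶ A, ∃ N : ℤ, N ≠ 0 ∧ End.of (N • g₀) ∈ Subring.closure {End.of (𝟙 A), End.of α, End.of β})
    (hZA : AbelianVariety.IsIsogenous Z (⨁ (fun _ : Fin (n + 1) => A)))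
    (hPm : P.Monic) (hPe : P.natDegree = e) (hPirr : Irreducible (P.map (Int.castRingHom ℚ)))
    (hφ : Polynomial.eval₂ (Int.castRingHom (CategoryTheory.End Z)) (End.of φ) P = 0)
    (her : e * (2 * m) = 2 * Z.dim) :
    (weilClassesField Z φ P (2 * m) ≤ hodgeClassSpan Z.dim Z.X m ∧
        weilClassesField Z φ P (2 * m) ≤ divisorClassesSpan Z.X Z.dim m) ↔
      (∀ ρ : ℂ, Polynomial.eval₂ (Int.castRingHom ℂ) ρ P = 0 →
          eigenMultiplicity Z φ ρ = eigenMultiplicity Z φ (starRingEnd ℂ ρ)) ∧ A.dim ∣ m := by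
  rw [Deligne1982.weilClassesField_le_hodgeClassSpan_iff_forall_eigenMultiplicity_eq hPm hPe hPirr hφ her,
    weilClassesField_le_divisorClassesSpan_iff_dvd_of_isIsogenous_biproduct_of_definiteQuaternion_End hA hh htop hnd ha hα2
      hb hβ2 hanti hαskew hβskew hD hZA hPm hPe hPirr hφ her]

/-- **THE TRICHOTOMY FOR `W_F(Z)`, TYPE 3 OVER `ℚ`, FOR EVERY `Z ∼ A^{n+1}`.**
[cite: MoonenZarhin1998WeilClasses, Introduction Q1–Q2 (chunk p0001 L46–L50) and §1 Criterion (2), first assertion (chunk p0003 L59–L67), type 3] -/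
theorem weilClassesField_not_le_hodgeClassSpan_or_le_divisorClassesSpan_or_of_isIsogenous_biproduct_of_definiteQuaternion_End
    (hA : 0 < A.dim) (hh : h ∈ hodgeClassSpan A.dim A.X 1) (htop : lefschetzPow h (A.dim - 1) 2 h ≠ 0)
    (hnd : ∀ x : complexBetti A.X 1, (∀ y, polarizationPairingOne A.X h (A.dim - 1) x y = 0) → x = 0)
    (ha : a ≠ 0) (hα2 : α ≫ α = a • 𝟙 A) (hb : b ≠ 0) (hβ2 : β ≫ β = b • 𝟙 A) (hanti : α ≫ β = -(β ≫ α))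
    (hαskew : ∀ v w : complexBetti A.X 1, polarizationPairingOne A.X h (A.dim - 1) (pullbackOne A α v) w =
      -polarizationPairingOne A.X h (A.dim - 1) v (pullbackOne A α w))
    (hβskew : ∀ v w : complexBetti A.X 1, polarizationPairingOne A.X h (A.dim - 1) (pullbackOne A β v) w =
      -polarizationPairingOne A.X h (A.dim - 1) v (pullbackOne A β w))
    (hD : ∀ g₀ : A ⟶ A, ∃ N : ℤ, N ≠ 0 ∧ End.of (N • g₀) ∈ Subring.closure {End.of (𝟙 A), End.of α, End.of β})
    (hZA : AbelianVariety.IsIsogenous Z (⨁ (fun _ : Fin (n + 1) => A)))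
    (hPm : P.Monic) (hPe : P.natDegree = e) (hPirr : Irreducible (P.map (Int.castRingHom ℚ)))
    (hφ : Polynomial.eval₂ (Int.castRingHom (CategoryTheory.End Z)) (End.of φ) P = 0)
    (her : e * (2 * m) = 2 * Z.dim) :
    ¬ weilClassesField Z φ P (2 * m) ≤ hodgeClassSpan Z.dim Z.X m ∨
      weilClassesField Z φ P (2 * m) ≤ divisorClassesSpan Z.X Z.dim m ∨
      (weilClassesField Z φ P (2 * m) ≤ hodgeClassSpan Z.dim Z.X m ∧
        weilClassesField Z φ P (2 * m) ⊓ divisorClassesSpan Z.X Z.dim m = ⊥) := by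
  by_cases hH : weilClassesField Z φ P (2 * m) ≤ hodgeClassSpan Z.dim Z.X m
  · rcases weilClassesField_le_or_inf_divisorClassesSpan_eq_bot_of_isIsogenous_biproduct_of_definiteQuaternion_End hA hh htop
        hnd ha hα2 hb hβ2 hanti hαskew hβskew hD hZA hPm hPe hPirr hφ her with hD' | hE
    · exact Or.inr (Or.inl hD')
    · exact Or.inr (Or.inr ⟨hH, hE⟩)
  · exact Or.inl hH

/-- **EXCEPTIONAL WEIL–HODGE CLASSES, TYPE 3 (centre `E = ℚ(ψ)`), FOR `Z` ISOGENOUS TO `A^{n+1}`, FROM `End(A)`**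
(explicit isogeny; `End⁰(A) = ℚ⟨ψ, α, β⟩` a definite quaternion algebra over `E = ℚ(ψ)`): `W_F(Z) ⊗ ℂ` consists of Hodge
classes all of whose non-zero members are exceptional IFF `n_ρ = n_ρ̄` at every root of `P` AND some per-place exponent
of the transported generator is odd.
[cite: MoonenZarhin1998WeilClasses, Introduction Q1–Q2 (chunk p0001 L46–L50), §1 (chunk p0002 L45–L46), Criterion (1) (section (crit1)) and Criterion (2), case «Y is of Type 3, m ≥ 2 and the integer 2m·[E:ℚ]/[F:ℚ] is odd» (chunk p0003 L59–L80, L107–L127; p0004 L1–L27)]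
[cite: Deligne1982HodgeCycles, Prop. 4.4] [cite: vanGeemen1994HodgeAV, 3.6 and proof of Lemma 5.2] [cite: MumfordAV1970, §19 Remark p. 169] -/
theorem weilClassesField_le_hodgeClassSpan_and_inf_divisorClassesSpan_eq_bot_iff_exists_odd_transport_of_isIsogeny_biproduct_of_definiteQuaternionOver_End
    (hA : 0 < A.dim) (hh : h ∈ hodgeClassSpan A.dim A.X 1) (htop : lefschetzPow h (A.dim - 1) 2 h ≠ 0)
    (hnd : ∀ x : complexBetti A.X 1, (∀ y, polarizationPairingOne A.X h (A.dim - 1) x y = 0) → x = 0)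
    (hψsym : ∀ v w : complexBetti A.X 1, polarizationPairingOne A.X h (A.dim - 1) (pullbackOne A ψ v) w =
      polarizationPairingOne A.X h (A.dim - 1) v (pullbackOne A ψ w))
    (hQm : Q.Monic) (hQirr : Irreducible (Q.map (Int.castRingHom ℚ)))
    (hψQ : Polynomial.eval₂ (Int.castRingHom (CategoryTheory.End A)) (ψ : CategoryTheory.End A) Q = 0)
    (hα2 : α ≫ α = Polynomial.eval₂ (Int.castRingHom (CategoryTheory.End A)) (ψ : CategoryTheory.End A) qa)
    (hqa : ∀ z : ℂ, (Q.map (Int.castRingHom ℂ)).IsRoot z → (qa.map (Int.castRingHom ℂ)).eval z ≠ 0)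
    (hβ2 : β ≫ β = Polynomial.eval₂ (Int.castRingHom (CategoryTheory.End A)) (ψ : CategoryTheory.End A) qb)
    (hqb : ∀ z : ℂ, (Q.map (Int.castRingHom ℂ)).IsRoot z → (qb.map (Int.castRingHom ℂ)).eval z ≠ 0)
    (hanti : α ≫ β = -(β ≫ α))
    (hαskew : ∀ v w : complexBetti A.X 1, polarizationPairingOne A.X h (A.dim - 1) (pullbackOne A α v) w =
      -polarizationPairingOne A.X h (A.dim - 1) v (pullbackOne A α w))
    (hβskew : ∀ v w : complexBetti A.X 1, polarizationPairingOne A.X h (A.dim - 1) (pullbackOne A β v) w =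
      -polarizationPairingOne A.X h (A.dim - 1) v (pullbackOne A β w))
    (hψα : ψ ≫ α = α ≫ ψ) (hψβ : ψ ≫ β = β ≫ ψ)
    (hD : ∀ g₀ : A ⟶ A, ∃ N : ℤ, N ≠ 0 ∧ End.of (N • g₀) ∈ Subring.closure {End.of ψ, End.of α, End.of β})
    (hf : AbelianVariety.IsIsogeny f) (hgf : g ≫ f = k • 𝟙 Z) (hfg : f ≫ g = k • 𝟙 (⨁ (fun _ : Fin (n + 1) => A)))
    (hk : k ≠ 0) (hPm : P.Monic) (hPe : P.natDegree = e) (hPirr : Irreducible (P.map (Int.castRingHom ℚ)))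
    (hφ : Polynomial.eval₂ (Int.castRingHom (CategoryTheory.End Z)) (End.of φ) P = 0)
    (her : e * (2 * m) = 2 * Z.dim) :
    (weilClassesField Z φ P (2 * m) ≤ hodgeClassSpan Z.dim Z.X m ∧
        weilClassesField Z φ P (2 * m) ⊓ divisorClassesSpan Z.X Z.dim m = ⊥) ↔
      (∀ ρ : ℂ, Polynomial.eval₂ (Int.castRingHom ℂ) ρ P = 0 →
          eigenMultiplicity Z φ ρ = eigenMultiplicity Z φ (starRingEnd ℂ ρ)) ∧
        ∃ ρ : ℂ, Polynomial.eval₂ (Int.castRingHom ℂ) ρ (P.scaleRoots (k : ℤ)) = 0 ∧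
          ∃ z : ℂ, (Q.map (Int.castRingHom ℂ)).IsRoot z ∧
            ∃ j : ℕ, 2 * Module.finrank ℂ ↥((pullbackOne (⨁ (fun _ : Fin (n + 1) => A)) (f ≫ φ ≫ g)).eigenspace ρ ⊓
                (pullbackOne (⨁ (fun _ : Fin (n + 1) => A)) (biproduct.map fun _ : Fin (n + 1) => ψ)).eigenspace z) =
              (2 * j + 1) * Module.finrank ℂ ↥((pullbackOne A ψ).eigenspace z) := by
  rw [Deligne1982.weilClassesField_le_hodgeClassSpan_iff_forall_eigenMultiplicity_eq hPm hPe hPirr hφ her,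
    weilClassesField_inf_divisorClassesSpan_eq_bot_iff_exists_odd_transport_of_isIsogeny_biproduct_of_definiteQuaternionOver_End
      hA hh htop hnd hψsym hQm hQirr hψQ hα2 hqa hβ2 hqb hanti hαskew hβskew hψα hψβ hD hf hgf hfg hk hPm hPe hPirr hφ her]

end ExceptionalHodge

end Literature.AlgebraicGeometry.HodgeTheory

end
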